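import Summits.CriticalPhenomena.Ising3D.TaylorCertificateOddCone
import Summits.CriticalPhenomena.Ising3D.TaylorOddQPoly
import Mathlib.Tactic.Linarith
import Mathlib.Tactic.Positivity
import Mathlib.Tactic.Ring
import HarnessLib

/-!
# The odd CONE condition of a derivative certificate at `(½,½)` is a polynomial check up to `(½)^{linear}` factors
(cell `pub-ising3x`, seat recog-1 gen 10; gate (g2), odd sector with (D5b): what the exact producer /
rational TABLE decides for `OddConeAt`)

HONEST FRAMING: lottery ticket; floor = tightest certified 3D Ising CFT bounds; no exact-solution
claim without a proof.

For `α = taylorCrossing ½ ½ S w` and a majorant `Ψ = Σ_{(a,b)∈Sψ} ψ(a,b) · taylorCoeffAt ½ ½ (a,b)`, at a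
monomial `𝒫_{E,j}` with `j ≤ E` (closed forms `sum_smul_taylorCoeffAt_crossF_zMono_half`):
`α³[F^{s̄}_-𝒫] = (½)^{Δσ+Δε}(½)^E q̂₃`, `α⁴[F^{Δσ}_-𝒫] - α⁵[F^{Δσ}_+𝒫] = (½)^{2Δσ}(½)^E (q̂₄ - q̂₅)`,
`Ψ(𝒫) = (½)^E ψ̂₀`, `Ψ(crossF (Δσ-Δε) 0 𝒫) = (½)^{2(Δσ-Δε)}(½)^E ψ̂_t` with the weighted q-sums
`q̂₃ = qSum (w 2) S s̄ (-1) E j`, `q̂₄ = qSum (w 3) S Δσ (-1) E j`, `q̂₅ = qSum (w 4) S Δσ 1 E j`,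
`ψ̂₀ = qSum ψ Sψ 0 0 E j`, `ψ̂_t = qSum ψ Sψ (Δσ-Δε) 0 E j`. Dividing by the positive prefactors,
`OddConeAt α Ψ κ₀ Δσ Δε E j` FOLLOWS from the two q-inequalities
(M̂) `(½)^{Δσ+Δε} |q̂₃| ≤ ψ̂₀` and (R̂) `½κ₀ (½)^{Δε-Δσ} |q̂₃| + ½κ₀⁻¹ (½)^{-2Δε} ψ̂_t ≤ q̂₄ - q̂₅`
(`oddConeAt_half_of_qCone`) — polynomial in `(E, j, Δσ, Δε)` with rational coefficients once `w, ψ, κ₀`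
are rational, times the three factors `(½)^{Δσ+Δε}`, `(½)^{Δε-Δσ}`, `(½)^{-2Δε}` which a table encloses by
rational intervals over the box (as `κ = (½)^{Δε-Δσ}` in `TaylorOddQPoly`). Sources: Kos–Poland–Simmons-Duffin
2014 §3.3 eq. (3.16); Dolan–Osborn 2004 §3 eq. (3.11).
-/

namespace Summit.CriticalPhenomena.Ising3D

open Finset Set
open Literature.MathematicalPhysics.QuantumFieldTheory.ConformalBootstrap3D

/-- A majorant functional at `(½,½)` on a bare monomial: `Ψ(𝒫_{E,j}) = (½)^E · qSum ψ Sψ 0 0 E j`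
(`j ≤ E`). [folklore] -/
theorem sum_smul_taylorCoeffAt_zMono_half (ψ : ℕ × ℕ → ℝ) (Sψ : Finset (ℕ × ℕ)) (E : ℝ) (j : ℕ)
    (hEj : (j : ℝ) ≤ E) :
    (∑ ab ∈ Sψ, ψ ab • taylorCoeffAt (1 / 2) (1 / 2) ab) (zMono E j) =
      (1 / 2 : ℝ) ^ E * qSum ψ Sψ 0 0 E j := by
  have h := sum_smul_taylorCoeffAt_crossF_zMono_half ψ Sψ 0 0 E j hEj
  rw [crossF_zero_zero] at h
  rw [h, mul_zero, Real.rpow_zero, one_mul]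

/-- **The q-form of the odd cone condition at `(½,½)`** (sufficient; see the module docstring).
[cite: KosPolandSimmonsduffin2014, §3.3 eq. (3.16)] -/
theorem oddConeAt_half_of_qCone (S : Finset (ℕ × ℕ)) (w : Fin 5 → ℕ × ℕ → ℝ)
    (Sψ : Finset (ℕ × ℕ)) (ψ : ℕ × ℕ → ℝ) (κ₀ Δσ Δε E : ℝ) (j : ℕ) (hj : (j : ℝ) ≤ E)
    (hM : (1 / 2 : ℝ) ^ (Δσ + Δε) * |qSum (w 2) S ((Δσ + Δε) / 2) (-1) E j| ≤ qSum ψ Sψ 0 0 E j)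
    (hR : κ₀ / 2 * ((1 / 2 : ℝ) ^ (Δε - Δσ) * |qSum (w 2) S ((Δσ + Δε) / 2) (-1) E j|) +
        κ₀⁻¹ / 2 * ((1 / 2 : ℝ) ^ (-(2 * Δε)) * qSum ψ Sψ (Δσ - Δε) 0 E j) ≤
      qSum (w 3) S Δσ (-1) E j - qSum (w 4) S Δσ 1 E j) :
    OddConeAt (taylorCrossing (1 / 2) (1 / 2) S w)
      (∑ ab ∈ Sψ, ψ ab • taylorCoeffAt (1 / 2) (1 / 2) ab) κ₀ Δσ Δε E j := by
  have h0 : (0 : ℝ) < 1 / 2 := by norm_num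
  have e3 : (taylorCrossing (1 / 2) (1 / 2) S w).α₃ (crossF ((Δσ + Δε) / 2) (-1) (zMono E j)) =
      (1 / 2 : ℝ) ^ (2 * ((Δσ + Δε) / 2)) * (1 / 2 : ℝ) ^ E * qSum (w 2) S ((Δσ + Δε) / 2) (-1) E j :=
    sum_smul_taylorCoeffAt_crossF_zMono_half _ _ _ _ _ _ hj
  have e4 : (taylorCrossing (1 / 2) (1 / 2) S w).α₄ (crossF Δσ (-1) (zMono E j)) =
      (1 / 2 : ℝ) ^ (2 * Δσ) * (1 / 2 : ℝ) ^ E * qSum (w 3) S Δσ (-1) E j :=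
    sum_smul_taylorCoeffAt_crossF_zMono_half _ _ _ _ _ _ hj
  have e5 : (taylorCrossing (1 / 2) (1 / 2) S w).α₅ (crossF Δσ 1 (zMono E j)) =
      (1 / 2 : ℝ) ^ (2 * Δσ) * (1 / 2 : ℝ) ^ E * qSum (w 4) S Δσ 1 E j :=
    sum_smul_taylorCoeffAt_crossF_zMono_half _ _ _ _ _ _ hj
  have eψ0 := sum_smul_taylorCoeffAt_zMono_half ψ Sψ E j hj
  have eψt : (∑ ab ∈ Sψ, ψ ab • taylorCoeffAt (1 / 2) (1 / 2) ab) (crossF (Δσ - Δε) 0 (zMono E j)) =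
      (1 / 2 : ℝ) ^ (2 * (Δσ - Δε)) * (1 / 2 : ℝ) ^ E * qSum ψ Sψ (Δσ - Δε) 0 E j :=
    sum_smul_taylorCoeffAt_crossF_zMono_half _ _ _ _ _ _ hj
  -- positive prefactors and how they factor through `P = (½)^{2Δσ} (½)^E`
  have hE : 0 < (1 / 2 : ℝ) ^ E := Real.rpow_pos_of_pos h0 _
  have hP : 0 < (1 / 2 : ℝ) ^ (2 * Δσ) * (1 / 2 : ℝ) ^ E :=
    mul_pos (Real.rpow_pos_of_pos h0 _) hE
  have hpre3 : 0 < (1 / 2 : ℝ) ^ (2 * ((Δσ + Δε) / 2)) * (1 / 2 : ℝ) ^ E :=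
    mul_pos (Real.rpow_pos_of_pos h0 _) hE
  have hs3a : (1 / 2 : ℝ) ^ (2 * ((Δσ + Δε) / 2)) = (1 / 2 : ℝ) ^ (Δσ + Δε) := by
    congr 1; ring
  have hs3b : (1 / 2 : ℝ) ^ (2 * ((Δσ + Δε) / 2)) = (1 / 2 : ℝ) ^ (2 * Δσ) * (1 / 2 : ℝ) ^ (Δε - Δσ) := by
    rw [← Real.rpow_add h0]; congr 1; ring
  have hst : (1 / 2 : ℝ) ^ (2 * (Δσ - Δε)) = (1 / 2 : ℝ) ^ (2 * Δσ) * (1 / 2 : ℝ) ^ (-(2 * Δε)) := by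
    rw [← Real.rpow_add h0]; congr 1; ring
  unfold OddConeAt
  rw [e3, e4, e5, eψ0, eψt, abs_mul, abs_of_pos hpre3]
  constructor
  · -- (M)
    rw [hs3a]
    calc (1 / 2 : ℝ) ^ (Δσ + Δε) * (1 / 2 : ℝ) ^ E * |qSum (w 2) S ((Δσ + Δε) / 2) (-1) E j|
        = (1 / 2 : ℝ) ^ E * ((1 / 2 : ℝ) ^ (Δσ + Δε) * |qSum (w 2) S ((Δσ + Δε) / 2) (-1) E j|) := by
          ring
      _ ≤ (1 / 2 : ℝ) ^ E * qSum ψ Sψ 0 0 E j := mul_le_mul_of_nonneg_left hM hE.le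
  · -- (R)
    rw [hs3b, hst]
    have key : κ₀ / 2 * ((1 / 2 : ℝ) ^ (2 * Δσ) * (1 / 2 : ℝ) ^ (Δε - Δσ) * (1 / 2 : ℝ) ^ E *
          |qSum (w 2) S ((Δσ + Δε) / 2) (-1) E j|) +
        κ₀⁻¹ / 2 * ((1 / 2 : ℝ) ^ (2 * Δσ) * (1 / 2 : ℝ) ^ (-(2 * Δε)) * (1 / 2 : ℝ) ^ E *
          qSum ψ Sψ (Δσ - Δε) 0 E j) =
        ((1 / 2 : ℝ) ^ (2 * Δσ) * (1 / 2 : ℝ) ^ E) *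
          (κ₀ / 2 * ((1 / 2 : ℝ) ^ (Δε - Δσ) * |qSum (w 2) S ((Δσ + Δε) / 2) (-1) E j|) +
            κ₀⁻¹ / 2 * ((1 / 2 : ℝ) ^ (-(2 * Δε)) * qSum ψ Sψ (Δσ - Δε) 0 E j)) := by ring
    have key2 : (1 / 2 : ℝ) ^ (2 * Δσ) * (1 / 2 : ℝ) ^ E * qSum (w 3) S Δσ (-1) E j -
        (1 / 2 : ℝ) ^ (2 * Δσ) * (1 / 2 : ℝ) ^ E * qSum (w 4) S Δσ 1 E j =
        ((1 / 2 : ℝ) ^ (2 * Δσ) * (1 / 2 : ℝ) ^ E) * (qSum (w 3) S Δσ (-1) E j - qSum (w 4) S Δσ 1 E j) := by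
      ring
    rw [key, key2]
    exact mul_le_mul_of_nonneg_left hR hP.le

end Summit.CriticalPhenomena.Ising3D
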